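import Mathlib.Analysis.SpecialFunctions.ExpDeriv
import Mathlib.Analysis.SpecialFunctions.Gaussian.GaussianIntegral
import Mathlib.Analysis.SpecialFunctions.Pow.Real
import Mathlib.MeasureTheory.Integral.IntegralEqImproper

/-!
# Stub `stub_modelValueSplitLine` (U2) of line `collapsed-ends-usc`, crux
# `EntropyRung.NoncompactShrinkerGap` (stmt-SmoothPoincare4-10868) — part 2: the Gaussian line

Helper file (`--supports`) for the registered stub `stub_modelValueSplitLine`: the `ℝ`-factor of the
split limit `N × ℝ`. The line `(ℝ, dt², ψ)` with `ψ(t) = t²/4` is the normalised one-dimensional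
Gaussian shrinker (`Hess ψ = ½ dt²`, `R + |ψ'|² = ψ'² = t²/4 = ψ`), and the `ℝ`-factor of the
test function is `F_K(ψ(t))` with the same cut Gaussian profile `F_K(s) = ρ(s/K) e^{-s/2}` as the
`N`-factor `F_K(φ(y))`. Proved here (Mathlib only):
* `integral_exp_neg_psi`, `integral_psi_mul_exp_neg_psi` — `∫ e^{-t²/4} dt = 2√π` and
  `∫ (t²/4) e^{-t²/4} dt = √π` (`= ½ · 2√π`, the 1-d case of `∫ φ e^{-φ} = (n/2) ∫ e^{-φ}`;
  Gaussian integral and an integration by parts on `(-∞, ∞)`), with the integrability of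
  `e^{-ψ}`, `ψ e^{-ψ}`;
* `hasDerivAt_psi`, `deriv_const_mul_comp_psi_sq`, `lineFactor_support` — calculus of the factor
  `t ↦ F(t²/4)`: `(d/dt [c F(t²/4)])² = c² (F'(t²/4)² · t²/4)`, support in `[-3K, 3K]` when
  `F = 0` on `[2K, ∞)`, `K ≥ 1`;
* `exists_index_of_limits` — the real-variable endgame: if the nine factor integrals of the cut
  test functions converge to their uncut values (`∫e^{-φ} = A > 0`, `∫Re^{-φ} + ∫|∇φ|²e^{-φ} =
  ∫φe^{-φ} = 3A/2`, `∫e^{-ψ} = B > 0`, `∫ψe^{-ψ} = B/2`), then Perelman's functional of `W_K`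
  tends to `log((4π)⁻² A B)` and `∫ W_K² → AB > 0`, so some `K` is `ε`-good.
No new definitions; everything is proved.
-/

noncomputable section

-- `Summit.SmoothPoincare4.SmoothPoincare4.…` (summit = problem) trips `dupNamespace` on every decl.
set_option linter.dupNamespace false

namespace Summit.SmoothPoincare4.SmoothPoincare4.Theorems.NoncompactShrinkerGapModelValueSplitLine

open MeasureTheory Filter Set
open scoped Topology ContDiff

/-! ### Gaussian integrals on the line `ψ(t) = t²/4` -/

/-- `ψ'(t) = t/2` for `ψ(t) = t²/4`. [folklore] -/
theorem hasDerivAt_psi (t : ℝ) : HasDerivAt (fun t : ℝ ↦ t ^ 2 / 4) (t / 2) t := by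
  refine (((hasDerivAt_id t).pow 2).div_const 4).congr_deriv ?_
  simp only [id, Nat.cast_ofNat, Nat.add_one_sub_one, pow_one, mul_one]
  ring

/-- `∫_ℝ e^{-t²/4} dt = 2√π` (Gaussian integral with `b = 1/4`). [folklore] -/
theorem integral_exp_neg_psi : ∫ t : ℝ, Real.exp (-(t ^ 2 / 4)) = 2 * Real.sqrt Real.pi := by
  have h := integral_gaussian (1 / 4 : ℝ)
  have h4 : Real.sqrt (Real.pi / (1 / 4)) = 2 * Real.sqrt Real.pi := by
    rw [div_div_eq_mul_div, div_one, show Real.pi * 4 = 2 ^ 2 * Real.pi by ring,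
      Real.sqrt_mul (by norm_num), Real.sqrt_sq (by norm_num)]
  rw [← h4, ← h]
  congr 1; ext t; congr 1; ring

/-- `e^{-t²/4}` is integrable. [folklore] -/
theorem integrable_exp_neg_psi : Integrable (fun t : ℝ ↦ Real.exp (-(t ^ 2 / 4))) := by
  have h := integrable_exp_neg_mul_sq (b := 1 / 4) (by norm_num)
  refine h.congr (Eventually.of_forall fun t ↦ ?_)
  simp only
  congr 1; ring

/-- `t² e^{-t²/4}` is integrable. [folklore] -/
theorem integrable_sq_mul_exp_neg_psi :
    Integrable (fun t : ℝ ↦ t ^ 2 * Real.exp (-(t ^ 2 / 4))) := by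
  have h := integrable_rpow_mul_exp_neg_mul_sq (b := 1 / 4) (by norm_num) (s := 2) (by norm_num)
  refine h.congr (Eventually.of_forall fun t ↦ ?_)
  simp only [Real.rpow_two]
  congr 2; ring

/-- `t e^{-t²/4}` is integrable. [folklore] -/
theorem integrable_mul_exp_neg_psi : Integrable (fun t : ℝ ↦ t * Real.exp (-(t ^ 2 / 4))) := by
  have h := integrable_mul_exp_neg_mul_sq (b := 1 / 4) (by norm_num)
  refine h.congr (Eventually.of_forall fun t ↦ ?_)
  simp only
  congr 2; ring

/-- `ψ e^{-ψ} = (t²/4) e^{-t²/4}` is integrable. [folklore] -/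
theorem integrable_psi_mul_exp_neg_psi :
    Integrable (fun t : ℝ ↦ t ^ 2 / 4 * Real.exp (-(t ^ 2 / 4))) := by
  refine (integrable_sq_mul_exp_neg_psi.const_mul (1 / 4)).congr (Eventually.of_forall fun t ↦ ?_)
  simp only; ring

/-- **`∫_ℝ t² e^{-t²/4} dt = 4√π`**: integration by parts on `(-∞, ∞)` with `u = t`,
`v = −2 e^{-t²/4}` (`v' = t e^{-t²/4}`), `∫ u v' = −∫ u' v = 2 ∫ e^{-t²/4}`. [folklore] -/
theorem integral_sq_mul_exp_neg_psi :
    ∫ t : ℝ, t ^ 2 * Real.exp (-(t ^ 2 / 4)) = 4 * Real.sqrt Real.pi := by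
  have hv : ∀ t : ℝ, HasDerivAt (fun t : ℝ ↦ -2 * Real.exp (-(t ^ 2 / 4)))
      (t * Real.exp (-(t ^ 2 / 4))) t := fun t ↦ by
    refine (((hasDerivAt_psi t).fun_neg).exp.const_mul (-2)).congr_deriv ?_
    ring
  have huv' : Integrable ((fun t : ℝ ↦ t) * fun t ↦ t * Real.exp (-(t ^ 2 / 4))) := by
    refine integrable_sq_mul_exp_neg_psi.congr (Eventually.of_forall fun t ↦ ?_)
    simp only [Pi.mul_apply]; ring
  have hu'v : Integrable ((fun _ : ℝ ↦ (1 : ℝ)) * fun t ↦ -2 * Real.exp (-(t ^ 2 / 4))) := by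
    refine (integrable_exp_neg_psi.const_mul (-2)).congr (Eventually.of_forall fun t ↦ ?_)
    simp only [Pi.mul_apply]; ring
  have huv : Integrable ((fun t : ℝ ↦ t) * fun t ↦ -2 * Real.exp (-(t ^ 2 / 4))) := by
    refine (integrable_mul_exp_neg_psi.const_mul (-2)).congr (Eventually.of_forall fun t ↦ ?_)
    simp only [Pi.mul_apply]; ring
  have ibp := integral_mul_deriv_eq_deriv_mul_of_integrable (u := fun t : ℝ ↦ t)
    (v := fun t ↦ -2 * Real.exp (-(t ^ 2 / 4))) (u' := fun _ ↦ (1 : ℝ))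
    (v' := fun t ↦ t * Real.exp (-(t ^ 2 / 4))) (fun t _ ↦ hasDerivAt_id t) (fun t _ ↦ hv t)
    huv' hu'v huv
  have hl : ∫ t : ℝ, t ^ 2 * Real.exp (-(t ^ 2 / 4)) =
      ∫ t : ℝ, t * (t * Real.exp (-(t ^ 2 / 4))) :=
    integral_congr_ae (Eventually.of_forall fun t ↦ by simp only; ring)
  rw [hl, ibp]
  have : ∀ t : ℝ, (1 : ℝ) * (-2 * Real.exp (-(t ^ 2 / 4))) = -2 * Real.exp (-(t ^ 2 / 4)) :=
    fun t ↦ by ring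
  simp_rw [this, integral_const_mul, integral_exp_neg_psi]
  ring

/-- **`∫_ℝ ψ e^{-ψ} dt = √π = ½ ∫_ℝ e^{-ψ} dt`** for `ψ = t²/4` — the one-dimensional case of the
shrinker identity `∫ φ e^{-φ} = (n/2) ∫ e^{-φ}`. [folklore] -/
theorem integral_psi_mul_exp_neg_psi :
    ∫ t : ℝ, t ^ 2 / 4 * Real.exp (-(t ^ 2 / 4)) = Real.sqrt Real.pi := by
  have : ∀ t : ℝ, t ^ 2 / 4 * Real.exp (-(t ^ 2 / 4)) =
      1 / 4 * (t ^ 2 * Real.exp (-(t ^ 2 / 4))) := fun t ↦ by ring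
  simp_rw [this, integral_const_mul, integral_sq_mul_exp_neg_psi]
  ring

/-! ### Calculus of the line factor `t ↦ F(t²/4)` -/

/-- `t ↦ F(t²/4)` is smooth for smooth `F`. [folklore] -/
theorem contDiff_comp_psi {F : ℝ → ℝ} (hF : ContDiff ℝ ∞ F) :
    ContDiff ℝ ∞ (fun t : ℝ ↦ F (t ^ 2 / 4)) :=
  hF.comp ((contDiff_id.pow 2).div_const 4)

/-- **`(d/dt [c · F(t²/4)])² = c² · (F'(t²/4)² · (t²/4))`** — the `t`-derivative term
`(∂_t W)² = F(φ)² · F'(ψ)² |∇ψ|²` with `|∇ψ|² = ψ'² = t²/4 = ψ`. [folklore] -/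
theorem deriv_const_mul_comp_psi_sq {F : ℝ → ℝ} {F' : ℝ} {t : ℝ} (hF' : HasDerivAt F F' (t ^ 2 / 4))
    (c : ℝ) : deriv (fun s : ℝ ↦ c * F (s ^ 2 / 4)) t ^ 2 = c ^ 2 * (F' ^ 2 * (t ^ 2 / 4)) := by
  have h1 : HasDerivAt (fun s : ℝ ↦ F (s ^ 2 / 4)) (F' * (t / 2)) t := hF'.comp t (hasDerivAt_psi t)
  rw [(h1.const_mul c).deriv]
  ring

/-- **Support of the line factor**: if `F = 0` on `[2K, ∞)` and `K ≥ 1` then `F(t²/4) = 0` off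
`[-3K, 3K]`; so `t ↦ F(t²/4)` has compact support with `tsupport ⊆ [-3K, 3K]`. [folklore] -/
theorem lineFactor_support {F : ℝ → ℝ} {K : ℝ} (hK : 1 ≤ K) (hF0 : ∀ s, 2 * K ≤ s → F s = 0) :
    (∀ t ∉ Icc (-(3 * K)) (3 * K), F (t ^ 2 / 4) = 0) ∧
    HasCompactSupport (fun t : ℝ ↦ F (t ^ 2 / 4)) ∧
    tsupport (fun t : ℝ ↦ F (t ^ 2 / 4)) ⊆ Icc (-(3 * K)) (3 * K) := by
  have hzero : ∀ t ∉ Icc (-(3 * K)) (3 * K), F (t ^ 2 / 4) = 0 := by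
    intro t ht
    refine hF0 _ ?_
    rw [mem_Icc, not_and_or, not_le, not_le] at ht
    have h9 : 9 * K ^ 2 ≤ t ^ 2 := by
      rcases ht with ht | ht <;> nlinarith
    nlinarith
  exact ⟨hzero, HasCompactSupport.intro' isCompact_Icc isClosed_Icc hzero,
    closure_minimal (fun t ht ↦ by by_contra h'; exact ht (hzero t h')) isClosed_Icc⟩

/-! ### The endgame: convergence of the functional along the cut-offs -/

/-- `(4π)^{-4/2} = ((4π)²)⁻¹` (real power versus natural power). [folklore] -/
theorem rpow_neg_four_div_two : (4 * Real.pi) ^ (-(4 : ℝ) / 2) = ((4 * Real.pi) ^ 2)⁻¹ := by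
  rw [neg_div, Real.rpow_neg (by positivity), show (4 : ℝ) / 2 = 2 by norm_num, Real.rpow_two]

/-- **The real-variable endgame.** Along the cut-offs `W_k` the functional is
`num_k / Z_k + log Z_k − log (4π)² − 4` with `Z_k = A₁B₁`,
`num_k = A₂B₁ + 4(A₃B₁ + A₁B₂) − ((A₄ − A₅)B₁ + A₁(B₃ − B₄))`; if `A₁ → A > 0` (`∫e^{-φ}`),
`A₂ → A_R`, `A₃ → A_G/4`, `A₄ → 0`, `A₅ → A_φ` with `A_R + A_G = A_φ = 3A/2` (normalisation and
Carrillo–Ni sharpness on `N`), and `B₁ → B > 0` (`∫e^{-ψ}`), `B₂ → B_ψ/4`, `B₃ → 0`,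
`B₄ → B_ψ = B/2`,
then `num_k → 4AB`, `Z_k → AB`, the functional tends to `log((4π)⁻² AB)` EXACTLY the model value,
and some `k` has `Z_k > 0` and functional `≤ log((4π)^{-4/2} · B A) + ε`. [folklore] -/
theorem exists_index_of_limits {A1 A2 A3 A4 A5 B1 B2 B3 B4 : ℕ → ℝ} {A AR AG Aφ B Bψ : ℝ}
    (hA : 0 < A) (hB : 0 < B) (hRG : AR + AG = Aφ) (hAφ : Aφ = 3 / 2 * A) (hBψ : Bψ = B / 2)
    (h1 : Tendsto A1 atTop (𝓝 A)) (h2 : Tendsto A2 atTop (𝓝 AR))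
    (h3 : Tendsto A3 atTop (𝓝 (1 / 4 * AG))) (h4 : Tendsto A4 atTop (𝓝 0))
    (h5 : Tendsto A5 atTop (𝓝 Aφ)) (h6 : Tendsto B1 atTop (𝓝 B))
    (h7 : Tendsto B2 atTop (𝓝 (1 / 4 * Bψ))) (h8 : Tendsto B3 atTop (𝓝 0))
    (h9 : Tendsto B4 atTop (𝓝 Bψ)) {ε : ℝ} (hε : 0 < ε) :
    ∃ k : ℕ, 0 < A1 k * B1 k ∧
      (A2 k * B1 k + 4 * (A3 k * B1 k + A1 k * B2 k) -
            ((A4 k - A5 k) * B1 k + A1 k * (B3 k - B4 k))) / (A1 k * B1 k) +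
          Real.log (A1 k * B1 k) - Real.log ((4 * Real.pi) ^ 2) - 4 ≤
        Real.log ((4 * Real.pi) ^ (-(4 : ℝ) / 2) * (B * A)) + ε := by
  have hAB : 0 < A * B := mul_pos hA hB
  have hZ : Tendsto (fun k ↦ A1 k * B1 k) atTop (𝓝 (A * B)) := h1.mul h6
  have hnum : Tendsto (fun k ↦ A2 k * B1 k + 4 * (A3 k * B1 k + A1 k * B2 k) -
      ((A4 k - A5 k) * B1 k + A1 k * (B3 k - B4 k))) atTop
      (𝓝 (AR * B + 4 * (1 / 4 * AG * B + A * (1 / 4 * Bψ)) - ((0 - Aφ) * B + A * (0 - Bψ)))) :=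
    ((h2.mul h6).add (((h3.mul h6).add (h1.mul h7)).const_mul 4)).sub
      (((h4.sub h5).mul h6).add (h1.mul (h8.sub h9)))
  have hval : AR * B + 4 * (1 / 4 * AG * B + A * (1 / 4 * Bψ)) - ((0 - Aφ) * B + A * (0 - Bψ)) =
      4 * (A * B) := by
    linear_combination B * hRG + 2 * B * hAφ + 2 * A * hBψ
  rw [hval] at hnum
  set L : ℝ := Real.log ((4 * Real.pi) ^ (-(4 : ℝ) / 2) * (B * A)) with hL
  have h4π : (0 : ℝ) < (4 * Real.pi) ^ 2 := by positivity
  have hLval : 4 * (A * B) / (A * B) + Real.log (A * B) - Real.log ((4 * Real.pi) ^ 2) - 4 = L := by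
    rw [mul_div_assoc, div_self hAB.ne', mul_one, hL, rpow_neg_four_div_two,
      Real.log_mul (inv_ne_zero h4π.ne') (mul_pos hB hA).ne', Real.log_inv, mul_comm B A]
    ring
  have hF : Tendsto (fun k ↦ (A2 k * B1 k + 4 * (A3 k * B1 k + A1 k * B2 k) -
      ((A4 k - A5 k) * B1 k + A1 k * (B3 k - B4 k))) / (A1 k * B1 k) +
      Real.log (A1 k * B1 k) - Real.log ((4 * Real.pi) ^ 2) - 4) atTop (𝓝 L) := by
    rw [← hLval]
    exact (((hnum.div hZ hAB.ne').add (hZ.log hAB.ne')).sub_const _).sub_const _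
  obtain ⟨k, hk1, hk2⟩ := ((hF.eventually_lt_const (show L < L + ε by linarith)).and
    (hZ.eventually_const_lt hAB)).exists
  exact ⟨k, hk2, hk1.le⟩

/-- **Registered sub-goal `stub_splitLineEndgame` of the crux** (the deciding statement of this
file): the real-variable endgame `exists_index_of_limits`, fully quantified. [folklore] -/
theorem stub_splitLineEndgame : ∀ (A1 A2 A3 A4 A5 B1 B2 B3 B4 : ℕ → ℝ) (A AR AG Aφ B Bψ : ℝ), 0 < A → 0 < B → AR + AG = Aφ → Aφ = 3 / 2 * A → Bψ = B / 2 → Filter.Tendsto A1 Filter.atTop (nhds A) → Filter.Tendsto A2 Filter.atTop (nhds AR) → Filter.Tendsto A3 Filter.atTop (nhds (1 / 4 * AG)) → Filter.Tendsto A4 Filter.atTop (nhds 0) → Filter.Tendsto A5 Filter.atTop (nhds Aφ) → Filter.Tendsto B1 Filter.atTop (nhds B) → Filter.Tendsto B2 Filter.atTop (nhds (1 / 4 * Bψ)) → Filter.Tendsto B3 Filter.atTop (nhds 0) → Filter.Tendsto B4 Filter.atTop (nhds Bψ) → ∀ ε : ℝ, 0 < ε → ∃ k : ℕ, 0 < A1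 k * B1 k ∧ (A2 k * B1 k + 4 * (A3 k * B1 k + A1 k * B2 k) - ((A4 k - A5 k) * B1 k + A1 k * (B3 k - B4 k))) / (A1 k * B1 k) + Real.log (A1 k * B1 k) - Real.log ((4 * Real.pi) ^ 2) - 4 ≤ Real.log ((4 * Real.pi) ^ (-(4 : ℝ) / 2) * (B * A)) + ε :=
  fun _ _ _ _ _ _ _ _ _ _ _ _ _ _ _ hA hB hRG hAφ hBψ h1 h2 h3 h4 h5 h6 h7 h8 h9 _ hε ↦
    exists_index_of_limits hA hB hRG hAφ hBψ h1 h2 h3 h4 h5 h6 h7 h8 h9 hε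

end Summit.SmoothPoincare4.SmoothPoincare4.Theorems.NoncompactShrinkerGapModelValueSplitLine

end
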